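import Mathlib
import HarnessLib
import Summits.SmoothPoincare4.SmoothPoincare4.Theses.ThreePointSpheres

/-!
# Birth skeleton (BC3) — crux `ThreePointSpheres.ThreePointDescent` (stmt-SmoothPoincare4-11169)

Route `route-SmoothPoincare4-ThreePointSpheres`, crux #4 `ThreePointDescent` (DESCENT, card item K2, complexity
reduction): every algebraically dual middle-level presentation `(N, k, S, P)` of a smooth homotopy 4-sphere
`M ≃ₕ S⁴` from `S⁴` (closed simply connected smooth `N`; framed families `S`, `P` of `k` disjoint 2-spheres,
transverse with `Sᵢ·Pⱼ = δᵢⱼ`; surgery along `P` gives `S⁴`, surgery along `S` gives `M`) can be replaced by ONE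
pair `(S', P')` in some `N'` with exactly THREE double points presenting the same `M` from `S⁴` — "the minimum of
the Morgan–Szabó complexity over h-cobordisms `S⁴ → M` is `≤ 2`", "every fake 4-sphere is a twist of `S⁴` along
Ladu's protocork `P₀`".

THE LINE = the route's own foreseen glued split of this node (route header, TWO-LAYER PLAN:
"ThreePointDescent ⇐ OnePairDescent (k = 1, any excess: Stabilisation's S1 in middle-level form, to be shared) →
ExcessReduction (k = 1: reduce the excess to 2 keeping Σ) → ThreePointDescent"), typed, with the excess
reduction cut once more at the only place where KNOWN mathematics separates from the open residue (the finger
move). Morgan–Szabó complexity of a one-pair presentation is `#(S ∩ P) − 1`; `S·P = 1` makes `#(S ∩ P)` odd, so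
"complexity ≤ 2" reads `#(S ∩ P) ∈ {1, 3}` (`Set.ncard` of an infinite set being `0`, the disjunction is also the
faithful finite form):

* `stub_one_pair_descent` (S1′ — OPEN, load-bearing): every algebraically dual presentation `(N, k, S, P)` of
  `M` from `S⁴` can be traded for a ONE-pair algebraically dual presentation `(N', S', P')` of the same `M` from
  `S⁴` (any number of double points). On paper `N' ≅ M # (S²×S²) ≅ S²×S²`: this is "one 2-handle/3-handle pair
  suffices for the h-cobordism `S⁴ → M`", the middle-level (h-cobordism) form of Stabilisation's crux
  `StabOneSuffices` (stmt-SmoothPoincare4-0386, `Σ # (S²×S²) ≅ S²×S²`) relativised to presentable `M` — the item the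
  route header says is "to be shared". Why it might fail: Wall/Kervaire–Milnor give SOME `k`, `k = 1` is Stern's
  Problem 14 / Kang's Question 1 for closed homotopy spheres; one `S²×S²` does NOT dissolve every cork
  (Kang2022 Thm 1.1), so an exotic `Σ` needing `k ≥ 2` kills it. [WallJLMS1964, Thm. 3] [Kang2022OneStabilization]
  [FreedmanGompfMorrisonWalker2010, §3] [Schwartz2020, §2]
* `stub_excess_at_most_two` (C≤2′ — OPEN, load-bearing; = the route's ExcessReduction): every ONE-pair
  algebraically dual presentation `(N, S, P)` of `M` from `S⁴` can be traded for a one-pair algebraically dual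
  presentation of the same `M` from `S⁴` whose pair has `1` or `3` double points — Morgan–Szabó complexity `≤ 2`
  on the one-pair sector (Ladu: complexity `2` ⟺ one pair, three points, signs `+,−,+` ⟺ `P₀`-twist). Why it might
  fail: no complexity-REDUCING Whitney/handle move keeping the surgery result is known; SW forces complexity `> N`
  at `b⁺ ≥ 1` (MorganSzabo1999 Thm 1.1, Ladu2025 Thm 1.2); a 1-stably-standard exotic `Σ` all of whose one-pair
  presentations need `≥ 5` points kills it. [MorganSzabo1999] [Ladu2025ComplexityTwo, §6.1] [Schwartz2020, Def. 2.3]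
* `stub_finger_move` (FM — KNOWN mathematics, formal size L): a one-pair GEOMETRICALLY dual presentation
  (`IsGeometricallyDual`: algebraically dual with exactly one double point) of `M` from `S⁴` can be traded for a
  one-pair algebraically dual presentation with exactly three double points of the same `M` from `S⁴`: push `S`
  across `P` along an arc in `N` (one finger move; Freedman–Quinn §1.5, Gompf–Stipsicz §1.2 / Fig. 1.4) — `N`, `P`
  unchanged, `S'` ambient-isotopic to `S`, two new transverse double points of opposite sign, so `S'·P = 1`,
  `#(S' ∩ P) = 3`, surgery along `S'` is surgery along `S` transported by the ambient diffeomorphism (still `M`),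
  surgery along `P` untouched (still `S⁴`). At `M = N = S⁴`, `k = 0` of the crux this stub, fed by the `S²×S²`
  model of `stub_one_pair_descent`, is exactly the finger-move three-point configuration the refuters isolated as
  the mandatory first prover milestone (evidence Witness.lean / Evidence.lean / HypSat.lean on the item).
  [FreedmanQuinn1990, §1.5] [GompfStipsicz1999, §1.2] [MilnorHCobordism1965, Def. 6.1]
* `threePointDescent_of_pieces : S1′-sig → C≤2′-sig → FM-sig → (ThreePointDescent unfolded)` — THE REAL
  COMPOSITION, sorry-free: given `(N, k, S, P)` presenting `M`, S1′ gives one pair; C≤2′ gives one pair with `1`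
  or `3` double points; `3`: done; `1`: over `Fin 1` the off-diagonal clause of `IsGeometricallyDual` is vacuous,
  so the pair is geometrically dual and FM gives three points.
* `ThreePointDescent_of : ThreePointDescent` — THE SKELETON THEOREM: the crux BY NAME from the three declared
  stubs through the composition (the file's only theorem whose head is the crux name).

`sorry` occurs ONLY in the three `stub_*` theorems (lean check: 3 sorries = 3 stubs, 0 elsewhere; axioms of
`threePointDescent_of_pieces`: propext, Classical.choice, Quot.sound).

Logical shape. Each stub is implied by the crux (S1′, C≤2′: forget structure; FM: its hypothesis is a `k = 1`
instance of the crux's), and the three together give it back: `ThreePointDescent ⟺ S1′ ∧ C≤2′ ∧ FM`. No stub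
gives the crux or `SmoothPoincare4` on its own (BC3 probes below): S1′ cannot reduce the excess, C≤2′ and FM
cannot digest a `k`-pair presentation, and none produces a diffeomorphism.

## Disproof used

None exists (2026-08-17): `ledger crux ls stmt-SmoothPoincare4-11169` — no `Disproof.lean`, no `Lines/*`, no crux
ideas, no landed `Negative/` lemma; `ledger negatives --problem SmoothPoincare4` lists no statement about
middle-level sphere pairs, stabilisation number or h-cobordism complexity. The refuter crux-attack evidence on
the item (Witness.lean, W2.lean, CruxAttackThreePointDescent.lean, Scratch.lean, Evidence.lean, HypSat.lean;
2026-08-15, all rc0) certifies what this skeleton inherits verbatim: the typing (`FramedSphereFamily`,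
`IsAlgebraicallyDual`, `doublePoints … .ncard = 3`, `IsSurgery` as open gluing; no junk values), non-vacuity at
`k = 0`, the parity fact that two transverse double points are incompatible with `S·P = 1` (whence `{1, 3}` in
C≤2′), and that the `k = 0` instance demands the finger-move model (= S1′ at `k = 0` + FM here).

## BC3 probes

For each stub `X ∈ {S1′, C≤2′, FM}` and each target `T ∈ {ThreePointDescent, SmoothPoincare4}` the implication
`X-signature → T` was attacked by five tactics, one `example` each under `set_option maxHeartbeats 400000`:
`exact?` (library search, which also tries the hypothesis itself through `solve_by_elim`) · `simpa` ·
`simpa [T and its definitional unfoldings]` · `aesop` · `(unfold T …; aesop)` — files `bc/probe_stub_*.lean` in the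
registrar's folder (each importing only Mathlib, HarnessLib and the route file; `lean check` rc 1 each, 2026-08-17).
ALL 30 FAIL: `exact?` — "could not close the goal" (6/6, definite); `simpa` / `simpa [defs]` / `aesop` /
`unfold; aesop` — deterministic `whnf` timeout at 400000 heartbeats with the goal open (24/24). No stub is cheaply
the crux or the summit; raw JSON in the registrar's NOTES.md (`birth-certificate:`).

## References

* J. Morgan, Z. Szabó, *Complexity of 4-dimensional h-cobordisms*, Invent. Math. 136 (1999), Thm 1.1. [MorganSzabo1999]
* R. Ladu, arXiv:2501.08750 (2025), §6.1, Thm 1.2, Cor. 1.3. [Ladu2025ComplexityTwo]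
* H. Schwartz, arXiv:1811.02753, Def. 2.3, §2. [Schwartz2020]
* C. T. C. Wall, J. London Math. Soc. 39 (1964), Thm. 3. [WallJLMS1964]
* S. Kang, *One stabilization is not enough for contractible 4-manifolds*, arXiv:2210.07510, Thm 1.1, Question 1. [Kang2022OneStabilization]
* M. Freedman, R. Gompf, S. Morrison, K. Walker, Quantum Topol. 1 (2010), §3. [FreedmanGompfMorrisonWalker2010]
* M. Freedman, F. Quinn, *Topology of 4-manifolds* (1990), §1.5 (finger moves). [FreedmanQuinn1990]
* R. Gompf, A. Stipsicz, *4-Manifolds and Kirby Calculus* (1999), §1.2, §5.2. [GompfStipsicz1999]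
* J. Milnor, *Lectures on the h-cobordism theorem* (1965), Def. 3.11, Def. 6.1. [MilnorHCobordism1965]
* R. Matveyev, J. Differential Geom. 44 (1996), Def. 1. [Matveyev1996]
* M. Kreck, *h-cobordisms between 1-connected 4-manifolds*, Geom. Topol. 5 (2001). [Kreck2001]
-/

-- `Summit.<Summit>.<Problem>`: single-conjunct summit, the duplicate component is mandated (CONVENTIONS §2).
set_option linter.dupNamespace false
set_option linter.unusedVariables false

noncomputable section

namespace Summit.SmoothPoincare4.SmoothPoincare4.Cruxes.ThreePointDescent.Birth

open scoped Manifold ContDiff Topology ContinuousMap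
open Summit.SmoothPoincare4.SmoothPoincare4.Theses.ThreePointSpheres

/-! ## The three registered stubs

Vocabulary (spelled out, Mathlib + the route's Literature imports only): `S⁴ := Metric.sphere (0 : EuclideanSpace ℝ (Fin 5)) 1`,
`S² := Metric.sphere (0 : EuclideanSpace ℝ (Fin 3)) 1`; a "presentation of `M` from `S⁴`" is the crux's own binder block — a
closed simply connected smooth `N` charted on `ℝ⁴`, orientations `oN`, `oS`, `oP`, framed sphere families
`S P : Literature.Topology.FourManifolds.FramedSphereFamily (𝓡 4) N (Fin k) 2 2` with
`Literature.Topology.FourManifolds.IsAlgebraicallyDual … S.sphere P.sphere`, `P.IsSurgery (𝓡 4) S⁴` and `S.IsSurgery (𝓡 4) M`. -/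

/-- **Stub S1′ `stub_one_pair_descent` — ONE PAIR SUFFICES (open, load-bearing).** Every algebraically dual
middle-level presentation `(N, k, S, P)` of a smooth homotopy 4-sphere `M ≃ₕ S⁴` from `S⁴` can be traded for a
one-pair algebraically dual presentation `(N', S', P')` (families over `Fin 1`, any number of double points) of the
same `M` from `S⁴`. The h-cobordism form of "one `S²×S²` summand suffices" (Stabilisation's `StabOneSuffices`,
stmt-SmoothPoincare4-0386, relativised to presentable `M`; on paper `N' ≅ M # (S²×S²) ≅ S²×S²`); at `k = 0` it is
the standard stabilisation model (`S²×S²` re-charted on `ℝ⁴` with its factor spheres). Why it might fail: an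
exotic `Σ` needing two `S²×S²` summands (Kang's Question 1 for closed manifolds; false for corks, Kang2022
Thm 1.1). [WallJLMS1964, Thm. 3] [Kang2022OneStabilization, Thm 1.1, Question 1]
[FreedmanGompfMorrisonWalker2010, §3] [Schwartz2020, §2] -/
theorem stub_one_pair_descent :
    ∀ (M : Type) [TopologicalSpace M] [T2Space M] [SecondCountableTopology M]
      [ChartedSpace (EuclideanSpace ℝ (Fin 4)) M] [IsManifold (𝓡 4) ∞ M]
      (_ : M ≃ₕ Metric.sphere (0 : EuclideanSpace ℝ (Fin 5)) 1)
      (N : Type) [TopologicalSpace N] [T2Space N] [SecondCountableTopology N]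
      [ChartedSpace (EuclideanSpace ℝ (Fin 4)) N] [IsManifold (𝓡 4) ∞ N] [CompactSpace N]
      [SimplyConnectedSpace N] (oN : Literature.Topology.FourManifolds.SmoothOrientation (𝓡 4) N)
      (oS oP : Literature.Topology.FourManifolds.SmoothOrientation (𝓡 2)
        (Metric.sphere (0 : EuclideanSpace ℝ (Fin 3)) 1))
      (k : ℕ) (S P : Literature.Topology.FourManifolds.FramedSphereFamily (𝓡 4) N (Fin k) 2 2),
      Literature.Topology.FourManifolds.IsAlgebraicallyDual (𝓡 2) (𝓡 2) (𝓡 4) two_add_two_eq_four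
        oS oP oN S.sphere P.sphere →
      P.IsSurgery (𝓡 4) (Metric.sphere (0 : EuclideanSpace ℝ (Fin 5)) 1) → S.IsSurgery (𝓡 4) M →
      ∃ (N' : Type) (_ : TopologicalSpace N') (_ : T2Space N') (_ : SecondCountableTopology N')
        (_ : ChartedSpace (EuclideanSpace ℝ (Fin 4)) N') (_ : IsManifold (𝓡 4) ∞ N') (_ : CompactSpace N')
        (_ : SimplyConnectedSpace N')
        (oN' : Literature.Topology.FourManifolds.SmoothOrientation (𝓡 4) N')
        (oS' oP' : Literature.Topology.FourManifolds.SmoothOrientation (𝓡 2)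
          (Metric.sphere (0 : EuclideanSpace ℝ (Fin 3)) 1))
        (S' P' : Literature.Topology.FourManifolds.FramedSphereFamily (𝓡 4) N' (Fin 1) 2 2),
        Literature.Topology.FourManifolds.IsAlgebraicallyDual (𝓡 2) (𝓡 2) (𝓡 4) two_add_two_eq_four
          oS' oP' oN' S'.sphere P'.sphere ∧
        P'.IsSurgery (𝓡 4) (Metric.sphere (0 : EuclideanSpace ℝ (Fin 5)) 1) ∧ S'.IsSurgery (𝓡 4) M := by
  sorry

/-- **Stub C≤2′ `stub_excess_at_most_two` — MORGAN–SZABÓ COMPLEXITY ≤ 2 ON THE ONE-PAIR SECTOR (open,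
load-bearing; the route's ExcessReduction).** Every one-pair algebraically dual presentation `(N, S, P)` of a
smooth homotopy 4-sphere `M ≃ₕ S⁴` from `S⁴` can be traded for a one-pair algebraically dual presentation
`(N', S', P')` of the same `M` from `S⁴` whose pair has `1` or `3` double points (complexity `#(S'∩P') − 1 ≤ 2`;
the even counts are excluded by `S'·P' = 1`, and `Set.ncard = 0` on infinite sets, so `{1, 3}` is the faithful
finite form of "≤ 3"). Complexity `2` ⟺ one pair, three points, signs `+,−,+` ⟺ Ladu's `P₀`-twist. Why it might
fail: no complexity-reducing move keeping the surgery result is known; SW forces complexity `> N` at `b⁺ ≥ 1`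
(MorganSzabo1999 Thm 1.1, Ladu2025 Thm 1.2); a 1-stably-standard exotic `Σ` whose one-pair presentations all
need `≥ 5` points kills it. [MorganSzabo1999, Thm 1.1] [Ladu2025ComplexityTwo, §6.1, Thm 1.2]
[Schwartz2020, Def. 2.3] [Kreck2001] -/
theorem stub_excess_at_most_two :
    ∀ (M : Type) [TopologicalSpace M] [T2Space M] [SecondCountableTopology M]
      [ChartedSpace (EuclideanSpace ℝ (Fin 4)) M] [IsManifold (𝓡 4) ∞ M]
      (_ : M ≃ₕ Metric.sphere (0 : EuclideanSpace ℝ (Fin 5)) 1)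
      (N : Type) [TopologicalSpace N] [T2Space N] [SecondCountableTopology N]
      [ChartedSpace (EuclideanSpace ℝ (Fin 4)) N] [IsManifold (𝓡 4) ∞ N] [CompactSpace N]
      [SimplyConnectedSpace N] (oN : Literature.Topology.FourManifolds.SmoothOrientation (𝓡 4) N)
      (oS oP : Literature.Topology.FourManifolds.SmoothOrientation (𝓡 2)
        (Metric.sphere (0 : EuclideanSpace ℝ (Fin 3)) 1))
      (S P : Literature.Topology.FourManifolds.FramedSphereFamily (𝓡 4) N (Fin 1) 2 2),
      Literature.Topology.FourManifolds.IsAlgebraicallyDual (𝓡 2) (𝓡 2) (𝓡 4) two_add_two_eq_four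
        oS oP oN S.sphere P.sphere →
      P.IsSurgery (𝓡 4) (Metric.sphere (0 : EuclideanSpace ℝ (Fin 5)) 1) → S.IsSurgery (𝓡 4) M →
      ∃ (N' : Type) (_ : TopologicalSpace N') (_ : T2Space N') (_ : SecondCountableTopology N')
        (_ : ChartedSpace (EuclideanSpace ℝ (Fin 4)) N') (_ : IsManifold (𝓡 4) ∞ N') (_ : CompactSpace N')
        (_ : SimplyConnectedSpace N')
        (oN' : Literature.Topology.FourManifolds.SmoothOrientation (𝓡 4) N')
        (oS' oP' : Literature.Topology.FourManifolds.SmoothOrientation (𝓡 2)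
          (Metric.sphere (0 : EuclideanSpace ℝ (Fin 3)) 1))
        (S' P' : Literature.Topology.FourManifolds.FramedSphereFamily (𝓡 4) N' (Fin 1) 2 2),
        Literature.Topology.FourManifolds.IsAlgebraicallyDual (𝓡 2) (𝓡 2) (𝓡 4) two_add_two_eq_four
          oS' oP' oN' S'.sphere P'.sphere ∧
        ((Literature.Topology.FourManifolds.doublePoints (S'.sphere 0) (P'.sphere 0)).ncard = 1 ∨
          (Literature.Topology.FourManifolds.doublePoints (S'.sphere 0) (P'.sphere 0)).ncard = 3) ∧
        P'.IsSurgery (𝓡 4) (Metric.sphere (0 : EuclideanSpace ℝ (Fin 5)) 1) ∧ S'.IsSurgery (𝓡 4) M := by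
  sorry

/-- **Stub FM `stub_finger_move` — THE FINGER MOVE `1 ↦ 3` (known mathematics; formal size L).** A one-pair
GEOMETRICALLY dual presentation `(N, S, P)` (`IsGeometricallyDual`: algebraically dual with exactly one double
point) of a smooth homotopy 4-sphere `M ≃ₕ S⁴` from `S⁴` can be traded for a one-pair algebraically dual
presentation with exactly three double points of the same `M` from `S⁴`: one finger move of `S` across `P` along
an arc in `N` (Freedman–Quinn §1.5; Gompf–Stipsicz §1.2) — `N`, `P` unchanged, `S'` ambient-isotopic to `S` with
two new transverse crossings of opposite local sign (`S'·P = 1`, `#(S'∩P) = 3`), surgery along `S'` = surgery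
along `S` transported by the ambient diffeomorphism (still `M`, cf. the tree's `IsOpenGluing` transport lemmas),
surgery along `P` untouched (still `S⁴`). With `stub_one_pair_descent` at `k = 0` this is the finger-move
three-point model of `S⁴` in `S²×S²` that the refuters' evidence (Witness.lean, Evidence.lean) shows every proof
of the crux must build. [FreedmanQuinn1990, §1.5] [GompfStipsicz1999, §1.2] [MilnorHCobordism1965, Def. 6.1]
[Matveyev1996, Def. 1] -/
theorem stub_finger_move :
    ∀ (M : Type) [TopologicalSpace M] [T2Space M] [SecondCountableTopology M]
      [ChartedSpace (EuclideanSpace ℝ (Fin 4)) M] [IsManifold (𝓡 4) ∞ M]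
      (_ : M ≃ₕ Metric.sphere (0 : EuclideanSpace ℝ (Fin 5)) 1)
      (N : Type) [TopologicalSpace N] [T2Space N] [SecondCountableTopology N]
      [ChartedSpace (EuclideanSpace ℝ (Fin 4)) N] [IsManifold (𝓡 4) ∞ N] [CompactSpace N]
      [SimplyConnectedSpace N] (oN : Literature.Topology.FourManifolds.SmoothOrientation (𝓡 4) N)
      (oS oP : Literature.Topology.FourManifolds.SmoothOrientation (𝓡 2)
        (Metric.sphere (0 : EuclideanSpace ℝ (Fin 3)) 1))
      (S P : Literature.Topology.FourManifolds.FramedSphereFamily (𝓡 4) N (Fin 1) 2 2),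
      Literature.Topology.FourManifolds.IsGeometricallyDual (𝓡 2) (𝓡 2) (𝓡 4) two_add_two_eq_four
        oS oP oN S.sphere P.sphere →
      P.IsSurgery (𝓡 4) (Metric.sphere (0 : EuclideanSpace ℝ (Fin 5)) 1) → S.IsSurgery (𝓡 4) M →
      ∃ (N' : Type) (_ : TopologicalSpace N') (_ : T2Space N') (_ : SecondCountableTopology N')
        (_ : ChartedSpace (EuclideanSpace ℝ (Fin 4)) N') (_ : IsManifold (𝓡 4) ∞ N') (_ : CompactSpace N')
        (_ : SimplyConnectedSpace N')
        (oN' : Literature.Topology.FourManifolds.SmoothOrientation (𝓡 4) N')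
        (oS' oP' : Literature.Topology.FourManifolds.SmoothOrientation (𝓡 2)
          (Metric.sphere (0 : EuclideanSpace ℝ (Fin 3)) 1))
        (S' P' : Literature.Topology.FourManifolds.FramedSphereFamily (𝓡 4) N' (Fin 1) 2 2),
        Literature.Topology.FourManifolds.IsAlgebraicallyDual (𝓡 2) (𝓡 2) (𝓡 4) two_add_two_eq_four
          oS' oP' oN' S'.sphere P'.sphere ∧
        (Literature.Topology.FourManifolds.doublePoints (S'.sphere 0) (P'.sphere 0)).ncard = 3 ∧
        P'.IsSurgery (𝓡 4) (Metric.sphere (0 : EuclideanSpace ℝ (Fin 5)) 1) ∧ S'.IsSurgery (𝓡 4) M := by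
  sorry

/-! ## The composition: the three stubs prove DESCENT -/

/-- Over a one-element index type the off-diagonal clauses of `IsGeometricallyDual` are vacuous: an
algebraically dual one-pair family with exactly one double point is geometrically dual (Matveyev 1996, Def. 1,
read over `Fin 1`). [Matveyev1996, Def. 1] -/
theorem isGeometricallyDual_of_ncard_eq_one_fin_one
    {N : Type} [TopologicalSpace N] [ChartedSpace (EuclideanSpace ℝ (Fin 4)) N] [IsManifold (𝓡 4) ∞ N]
    {oN : Literature.Topology.FourManifolds.SmoothOrientation (𝓡 4) N}
    {oS oP : Literature.Topology.FourManifolds.SmoothOrientation (𝓡 2)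
      (Metric.sphere (0 : EuclideanSpace ℝ (Fin 3)) 1)}
    {S P : Fin 1 → (Metric.sphere (0 : EuclideanSpace ℝ (Fin 3)) 1) → N}
    (hd : Literature.Topology.FourManifolds.IsAlgebraicallyDual (𝓡 2) (𝓡 2) (𝓡 4) two_add_two_eq_four
      oS oP oN S P)
    (h1 : (Literature.Topology.FourManifolds.doublePoints (S 0) (P 0)).ncard = 1) :
    Literature.Topology.FourManifolds.IsGeometricallyDual (𝓡 2) (𝓡 2) (𝓡 4) two_add_two_eq_four
      oS oP oN S P := by
  refine ⟨hd, fun i => ⟨?_, fun j hij => absurd (Subsingleton.elim i j) hij⟩⟩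
  obtain rfl : i = 0 := Subsingleton.elim i 0
  exact h1

/-- **Composition with explicit hypotheses** (`S1′-sig → C≤2′-sig → FM-sig → DESCENT`, the conclusion written
as the crux's one-step unfolding so that `ThreePointDescent_of` below is the file's only theorem whose head is
the crux name). Proof: given `(N, k, S, P)` presenting `M` from `S⁴`, S1′ yields one pair; C≤2′ yields one pair
with `1` or `3` double points; with `3` we are done; with `1` the pair is geometrically dual
(`isGeometricallyDual_of_ncard_eq_one_fin_one`) and FM yields three points. Sorry-free, standard axioms.
[folklore] -/
theorem threePointDescent_of_pieces
    (h₁ : ∀ (M : Type) [TopologicalSpace M] [T2Space M] [SecondCountableTopology M]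
      [ChartedSpace (EuclideanSpace ℝ (Fin 4)) M] [IsManifold (𝓡 4) ∞ M]
      (_ : M ≃ₕ Metric.sphere (0 : EuclideanSpace ℝ (Fin 5)) 1)
      (N : Type) [TopologicalSpace N] [T2Space N] [SecondCountableTopology N]
      [ChartedSpace (EuclideanSpace ℝ (Fin 4)) N] [IsManifold (𝓡 4) ∞ N] [CompactSpace N]
      [SimplyConnectedSpace N] (oN : Literature.Topology.FourManifolds.SmoothOrientation (𝓡 4) N)
      (oS oP : Literature.Topology.FourManifolds.SmoothOrientation (𝓡 2)
        (Metric.sphere (0 : EuclideanSpace ℝ (Fin 3)) 1))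
      (k : ℕ) (S P : Literature.Topology.FourManifolds.FramedSphereFamily (𝓡 4) N (Fin k) 2 2),
      Literature.Topology.FourManifolds.IsAlgebraicallyDual (𝓡 2) (𝓡 2) (𝓡 4) two_add_two_eq_four
        oS oP oN S.sphere P.sphere →
      P.IsSurgery (𝓡 4) (Metric.sphere (0 : EuclideanSpace ℝ (Fin 5)) 1) → S.IsSurgery (𝓡 4) M →
      ∃ (N' : Type) (_ : TopologicalSpace N') (_ : T2Space N') (_ : SecondCountableTopology N')
        (_ : ChartedSpace (EuclideanSpace ℝ (Fin 4)) N') (_ : IsManifold (𝓡 4) ∞ N') (_ : CompactSpace N')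
        (_ : SimplyConnectedSpace N')
        (oN' : Literature.Topology.FourManifolds.SmoothOrientation (𝓡 4) N')
        (oS' oP' : Literature.Topology.FourManifolds.SmoothOrientation (𝓡 2)
          (Metric.sphere (0 : EuclideanSpace ℝ (Fin 3)) 1))
        (S' P' : Literature.Topology.FourManifolds.FramedSphereFamily (𝓡 4) N' (Fin 1) 2 2),
        Literature.Topology.FourManifolds.IsAlgebraicallyDual (𝓡 2) (𝓡 2) (𝓡 4) two_add_two_eq_four
          oS' oP' oN' S'.sphere P'.sphere ∧
        P'.IsSurgery (𝓡 4) (Metric.sphere (0 : EuclideanSpace ℝ (Fin 5)) 1) ∧ S'.IsSurgery (𝓡 4) M)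
    (h₂ : ∀ (M : Type) [TopologicalSpace M] [T2Space M] [SecondCountableTopology M]
      [ChartedSpace (EuclideanSpace ℝ (Fin 4)) M] [IsManifold (𝓡 4) ∞ M]
      (_ : M ≃ₕ Metric.sphere (0 : EuclideanSpace ℝ (Fin 5)) 1)
      (N : Type) [TopologicalSpace N] [T2Space N] [SecondCountableTopology N]
      [ChartedSpace (EuclideanSpace ℝ (Fin 4)) N] [IsManifold (𝓡 4) ∞ N] [CompactSpace N]
      [SimplyConnectedSpace N] (oN : Literature.Topology.FourManifolds.SmoothOrientation (𝓡 4) N)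
      (oS oP : Literature.Topology.FourManifolds.SmoothOrientation (𝓡 2)
        (Metric.sphere (0 : EuclideanSpace ℝ (Fin 3)) 1))
      (S P : Literature.Topology.FourManifolds.FramedSphereFamily (𝓡 4) N (Fin 1) 2 2),
      Literature.Topology.FourManifolds.IsAlgebraicallyDual (𝓡 2) (𝓡 2) (𝓡 4) two_add_two_eq_four
        oS oP oN S.sphere P.sphere →
      P.IsSurgery (𝓡 4) (Metric.sphere (0 : EuclideanSpace ℝ (Fin 5)) 1) → S.IsSurgery (𝓡 4) M →
      ∃ (N' : Type) (_ : TopologicalSpace N') (_ : T2Space N') (_ : SecondCountableTopology N')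
        (_ : ChartedSpace (EuclideanSpace ℝ (Fin 4)) N') (_ : IsManifold (𝓡 4) ∞ N') (_ : CompactSpace N')
        (_ : SimplyConnectedSpace N')
        (oN' : Literature.Topology.FourManifolds.SmoothOrientation (𝓡 4) N')
        (oS' oP' : Literature.Topology.FourManifolds.SmoothOrientation (𝓡 2)
          (Metric.sphere (0 : EuclideanSpace ℝ (Fin 3)) 1))
        (S' P' : Literature.Topology.FourManifolds.FramedSphereFamily (𝓡 4) N' (Fin 1) 2 2),
        Literature.Topology.FourManifolds.IsAlgebraicallyDual (𝓡 2) (𝓡 2) (𝓡 4) two_add_two_eq_four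
          oS' oP' oN' S'.sphere P'.sphere ∧
        ((Literature.Topology.FourManifolds.doublePoints (S'.sphere 0) (P'.sphere 0)).ncard = 1 ∨
          (Literature.Topology.FourManifolds.doublePoints (S'.sphere 0) (P'.sphere 0)).ncard = 3) ∧
        P'.IsSurgery (𝓡 4) (Metric.sphere (0 : EuclideanSpace ℝ (Fin 5)) 1) ∧ S'.IsSurgery (𝓡 4) M)
    (h₃ : ∀ (M : Type) [TopologicalSpace M] [T2Space M] [SecondCountableTopology M]
      [ChartedSpace (EuclideanSpace ℝ (Fin 4)) M] [IsManifold (𝓡 4) ∞ M]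
      (_ : M ≃ₕ Metric.sphere (0 : EuclideanSpace ℝ (Fin 5)) 1)
      (N : Type) [TopologicalSpace N] [T2Space N] [SecondCountableTopology N]
      [ChartedSpace (EuclideanSpace ℝ (Fin 4)) N] [IsManifold (𝓡 4) ∞ N] [CompactSpace N]
      [SimplyConnectedSpace N] (oN : Literature.Topology.FourManifolds.SmoothOrientation (𝓡 4) N)
      (oS oP : Literature.Topology.FourManifolds.SmoothOrientation (𝓡 2)
        (Metric.sphere (0 : EuclideanSpace ℝ (Fin 3)) 1))
      (S P : Literature.Topology.FourManifolds.FramedSphereFamily (𝓡 4) N (Fin 1) 2 2),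
      Literature.Topology.FourManifolds.IsGeometricallyDual (𝓡 2) (𝓡 2) (𝓡 4) two_add_two_eq_four
        oS oP oN S.sphere P.sphere →
      P.IsSurgery (𝓡 4) (Metric.sphere (0 : EuclideanSpace ℝ (Fin 5)) 1) → S.IsSurgery (𝓡 4) M →
      ∃ (N' : Type) (_ : TopologicalSpace N') (_ : T2Space N') (_ : SecondCountableTopology N')
        (_ : ChartedSpace (EuclideanSpace ℝ (Fin 4)) N') (_ : IsManifold (𝓡 4) ∞ N') (_ : CompactSpace N')
        (_ : SimplyConnectedSpace N')
        (oN' : Literature.Topology.FourManifolds.SmoothOrientation (𝓡 4) N')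
        (oS' oP' : Literature.Topology.FourManifolds.SmoothOrientation (𝓡 2)
          (Metric.sphere (0 : EuclideanSpace ℝ (Fin 3)) 1))
        (S' P' : Literature.Topology.FourManifolds.FramedSphereFamily (𝓡 4) N' (Fin 1) 2 2),
        Literature.Topology.FourManifolds.IsAlgebraicallyDual (𝓡 2) (𝓡 2) (𝓡 4) two_add_two_eq_four
          oS' oP' oN' S'.sphere P'.sphere ∧
        (Literature.Topology.FourManifolds.doublePoints (S'.sphere 0) (P'.sphere 0)).ncard = 3 ∧
        P'.IsSurgery (𝓡 4) (Metric.sphere (0 : EuclideanSpace ℝ (Fin 5)) 1) ∧ S'.IsSurgery (𝓡 4) M) :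
    ∀ (M : Type) [TopologicalSpace M] [T2Space M] [SecondCountableTopology M]
      [ChartedSpace (EuclideanSpace ℝ (Fin 4)) M] [IsManifold (𝓡 4) ∞ M]
      (_ : M ≃ₕ Metric.sphere (0 : EuclideanSpace ℝ (Fin 5)) 1)
      (N : Type) [TopologicalSpace N] [T2Space N] [SecondCountableTopology N]
      [ChartedSpace (EuclideanSpace ℝ (Fin 4)) N] [IsManifold (𝓡 4) ∞ N] [CompactSpace N]
      [SimplyConnectedSpace N] (oN : Literature.Topology.FourManifolds.SmoothOrientation (𝓡 4) N)
      (oS oP : Literature.Topology.FourManifolds.SmoothOrientation (𝓡 2)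
        (Metric.sphere (0 : EuclideanSpace ℝ (Fin 3)) 1))
      (k : ℕ) (S P : Literature.Topology.FourManifolds.FramedSphereFamily (𝓡 4) N (Fin k) 2 2),
      Literature.Topology.FourManifolds.IsAlgebraicallyDual (𝓡 2) (𝓡 2) (𝓡 4) two_add_two_eq_four
        oS oP oN S.sphere P.sphere →
      P.IsSurgery (𝓡 4) (Metric.sphere (0 : EuclideanSpace ℝ (Fin 5)) 1) → S.IsSurgery (𝓡 4) M →
      ∃ (N' : Type) (_ : TopologicalSpace N') (_ : T2Space N') (_ : SecondCountableTopology N')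
        (_ : ChartedSpace (EuclideanSpace ℝ (Fin 4)) N') (_ : IsManifold (𝓡 4) ∞ N') (_ : CompactSpace N')
        (_ : SimplyConnectedSpace N')
        (oN' : Literature.Topology.FourManifolds.SmoothOrientation (𝓡 4) N')
        (oS' oP' : Literature.Topology.FourManifolds.SmoothOrientation (𝓡 2)
          (Metric.sphere (0 : EuclideanSpace ℝ (Fin 3)) 1))
        (S' P' : Literature.Topology.FourManifolds.FramedSphereFamily (𝓡 4) N' (Fin 1) 2 2),
        Literature.Topology.FourManifolds.IsAlgebraicallyDual (𝓡 2) (𝓡 2) (𝓡 4) two_add_two_eq_four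
          oS' oP' oN' S'.sphere P'.sphere ∧
        (Literature.Topology.FourManifolds.doublePoints (S'.sphere 0) (P'.sphere 0)).ncard = 3 ∧
        P'.IsSurgery (𝓡 4) (Metric.sphere (0 : EuclideanSpace ℝ (Fin 5)) 1) ∧ S'.IsSurgery (𝓡 4) M := by
  intro M _ _ _ _ _ e N _ _ _ _ _ _ _ oN oS oP k S P hdual hPS hSM
  -- S1′: one algebraically dual pair presenting the same M from S⁴
  obtain ⟨N₁, _, _, _, _, _, _, _, oN₁, oS₁, oP₁, S₁, P₁, hdual₁, hPS₁, hSM₁⟩ :=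
    h₁ M e N oN oS oP k S P hdual hPS hSM
  -- C≤2′: one pair with 1 or 3 double points
  obtain ⟨N₂, j₁, j₂, j₃, j₄, j₅, j₆, j₇, oN₂, oS₂, oP₂, S₂, P₂, hdual₂, h13, hPS₂, hSM₂⟩ :=
    h₂ M e N₁ oN₁ oS₁ oP₁ S₁ P₁ hdual₁ hPS₁ hSM₁
  rcases h13 with h1 | h3
  · -- one double point: the pair is geometrically dual; finger move to three points
    exact h₃ M e N₂ oN₂ oS₂ oP₂ S₂ P₂ (isGeometricallyDual_of_ncard_eq_one_fin_one hdual₂ h1) hPS₂ hSM₂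
  · -- already three double points
    exact ⟨N₂, j₁, j₂, j₃, j₄, j₅, j₆, j₇, oN₂, oS₂, oP₂, S₂, P₂, hdual₂, h3, hPS₂, hSM₂⟩

/-- **THE SKELETON THEOREM.** The crux `Summit.SmoothPoincare4.SmoothPoincare4.Theses.ThreePointSpheres.ThreePointDescent`,
concluded BY NAME from the three DECLARED stubs `stub_one_pair_descent`, `stub_excess_at_most_two`,
`stub_finger_move` (the only `sorry`s of the file) through the sorry-free composition
`threePointDescent_of_pieces`. [folklore] -/
theorem ThreePointDescent_of :
    Summit.SmoothPoincare4.SmoothPoincare4.Theses.ThreePointSpheres.ThreePointDescent :=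
  threePointDescent_of_pieces stub_one_pair_descent stub_excess_at_most_two stub_finger_move

end Summit.SmoothPoincare4.SmoothPoincare4.Cruxes.ThreePointDescent.Birth

end
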